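import Summits.AtomisticToContinuum.Crystallization.Theorems.PerronTransitivityUniformBindingRigidityCohesionB

/-!
# Cohesion of uniformly bound Lennard-Jones configurations, III: site bounds pass to local limits

Helper file (`--supports stmt-AtomisticToContinuum-15099`) of the stub `stub_cohesion` of the line
`registered` (skeleton `Cruxes/UniformBindingRigidity/Lines/birth.lean`) of the crux
`Summit.AtomisticToContinuum.Crystallization.Theses.PerronTransitivity.UniformBindingRigidity`
(item stmt-AtomisticToContinuum-15099), continuing parts I–II (`…CohesionA/B.lean`).

The one analytic input of the compactness reduction of part IV (the stub is EQUIVALENT to the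
non-existence of uniformly `2e*`-bound half-space configurations):

* §7 finite Lennard-Jones site sums `(a, b) ↦ Σᵢ V_LJ(dist a bᵢ)` are continuous off the diagonal
  (`continuousAt_sum_lennardJones_dist`);
* §8 `tsum_site_le_of_forall_exists_ballMatch` — **uniform site bounds pass to local limits**: if a
  `δ`-separated `Y ⊆ ℝ³` is, on every ball `‖·‖ ≤ R` and at every tolerance `ε > 0`, two-way
  `ε`-matched (`BallMatch ε R 0 Z Y`) with some `δ`-separated `Z` all of whose site sums are `≤ B`,
  then all site sums of `Y` are `≤ B`.  Proof: fix `p ∈ Y`, `η > 0` and a radius `L` with tail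
  `(1/6)·1024/(δ³(L−1)³) ≤ η/3`; the site sum of `Y` at `p` is at most its near part (points within
  `L`; the far terms are `≤ 0` as `L ≥ 1`); match at a tolerance below the continuity modulus of the
  near sum and below `δ/4`: the near points of `Y` go injectively to points of `Z` near the partner
  `a` of `p`, every point of `Z` within `L − 1` of `a` is hit (two-way matching + separation), so by
  the truncation inequality of part II the matched sum is `≤ B + η/3`, and continuity gives the near
  sum of `Y` up to another `η/3`.  (Same mechanism as the tree's
  `ExcessDecayLiouvilleGrainsGlue.hasSum_force_of_forall_exists_ballMatch` for forces.)

All `[folklore]`.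
-/

noncomputable section

namespace Summit.AtomisticToContinuum.Crystallization.Theorems.PerronTransitivityUniformBindingRigidity

open scoped BigOperators Topology
open Filter Set Metric
open Literature.MathematicalPhysics.StatisticalMechanics
open Summit.AtomisticToContinuum.Crystallization.Theorems.ChargedEnergyGapNegative (E3)

/-! ## §7 Continuity of finite site sums off the diagonal -/

/-- `(a, b) ↦ V_LJ(dist a (b i))` is continuous at every `(a₀, b₀)` with `a₀ ≠ b₀ i`
(`V_LJ` is continuous off `0`, tree: `continuousOn_lennardJones`). [folklore] -/
theorem continuousAt_lennardJones_dist_apply {ι : Type*} [Fintype ι] (i : ι)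
    {v₀ : E3 × (ι → E3)} (h : v₀.1 ≠ v₀.2 i) :
    ContinuousAt (fun v : E3 × (ι → E3) => lennardJones (dist v.1 (v.2 i))) v₀ := by
  have hd : Continuous fun v : E3 × (ι → E3) => dist v.1 (v.2 i) :=
    continuous_fst.dist ((continuous_apply i).comp continuous_snd)
  have hd0 : dist v₀.1 (v₀.2 i) ≠ 0 := dist_ne_zero.2 h
  have hV : ContinuousAt lennardJones (dist v₀.1 (v₀.2 i)) :=
    continuousOn_lennardJones.continuousAt (isOpen_compl_singleton.mem_nhds hd0)
  exact ContinuousAt.comp_of_eq hV hd.continuousAt rfl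

/-- The finite site sum `(a, b) ↦ Σᵢ V_LJ(dist a (b i))` is continuous at every `(a₀, b₀)` with
`a₀ ≠ b₀ i` for all `i`. [folklore] -/
theorem continuousAt_sum_lennardJones_dist {ι : Type*} [Fintype ι] {v₀ : E3 × (ι → E3)}
    (h : ∀ i, v₀.1 ≠ v₀.2 i) :
    ContinuousAt (fun v : E3 × (ι → E3) => ∑ i, lennardJones (dist v.1 (v.2 i))) v₀ := by
  have := tendsto_finsetSum (Finset.univ : Finset ι)
    (f := fun i (v : E3 × (ι → E3)) => lennardJones (dist v.1 (v.2 i))) (x := 𝓝 v₀)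
    (a := fun i => lennardJones (dist v₀.1 (v₀.2 i)))
    fun i _ => continuousAt_lennardJones_dist_apply i (h i)
  exact this

/-! ## §8 Uniform site bounds pass to local limits -/

/-- **Uniform site bounds pass to local limits.** Let `Y ⊆ ℝ³` be `δ`-separated (`δ > 0`) and
suppose that for every radius `R` and tolerance `ε > 0` some `δ`-separated `Z ⊆ ℝ³` all of whose
Lennard-Jones site sums are `≤ B` is two-way `ε`-matched with `Y` on the ball `‖·‖ ≤ R`
(`BallMatch ε R 0 Z Y`).  Then every site sum of `Y` is `≤ B`. [folklore] -/
theorem tsum_site_le_of_forall_exists_ballMatch {δ B : ℝ} (hδ : 0 < δ) {Y : Set E3}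
    (hsep : ∀ p ∈ Y, ∀ q ∈ Y, p ≠ q → δ ≤ dist p q)
    (happrox : ∀ R ε : ℝ, 0 < ε → ∃ Z : Set E3,
        (∀ p ∈ Z, ∀ q ∈ Z, p ≠ q → δ ≤ dist p q) ∧
        (∀ p ∈ Z, ∑' q : {q : E3 // q ∈ Z ∧ q ≠ p}, lennardJones (dist p q.1) ≤ B) ∧
        BallMatch ε R 0 Z Y)
    {p : E3} (hp : p ∈ Y) :
    ∑' q : {q : E3 // q ∈ Y ∧ q ≠ p}, lennardJones (dist p q.1) ≤ B := by
  classical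
  -- normalise the separation constant to `δ' ≤ 1`
  set δ' : ℝ := min δ 1 with hδ'
  have hδ'0 : 0 < δ' := lt_min hδ one_pos
  have hδ'1 : δ' ≤ 1 := min_le_right _ _
  have hδ'δ : δ' ≤ δ := min_le_left _ _
  have hsep' : ∀ p ∈ Y, ∀ q ∈ Y, p ≠ q → δ' ≤ dist p q := fun p hp q hq hpq =>
    hδ'δ.trans (hsep p hp q hq hpq)
  set f : {q : E3 // q ∈ Y ∧ q ≠ p} → ℝ := fun q => lennardJones (dist p q.1) with hf
  have hsumm : Summable f := summable_site hδ'0 hsep' hp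
  refine le_of_forall_pos_le_add fun η hη => ?_
  -- the splitting radius `L`
  obtain ⟨L, hL2, hLtail⟩ : ∃ L : ℝ, 2 ≤ L ∧ 1 / 6 * (1024 / (δ' ^ 3 * (L - 1) ^ 3)) ≤ η / 3 := by
    set M : ℝ := max 1 (512 / (δ' ^ 3 * η)) with hM
    have hM1 : 1 ≤ M := le_max_left _ _
    have hMge : 512 / (δ' ^ 3 * η) ≤ M := le_max_right _ _
    have hδ3 : 0 < δ' ^ 3 := by positivity
    refine ⟨M + 1, by linarith, ?_⟩
    rw [show M + 1 - 1 = M by ring]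
    have hM3 : M ≤ M ^ 3 := by
      calc M = M * 1 * 1 := by ring
        _ ≤ M * M * M := by gcongr
        _ = M ^ 3 := by ring
    have h1 : 512 ≤ δ' ^ 3 * η * M := by
      rw [div_le_iff₀ (by positivity)] at hMge; linarith
    have h2 : 512 ≤ δ' ^ 3 * η * M ^ 3 := h1.trans (mul_le_mul_of_nonneg_left hM3 (by positivity))
    rw [show 1 / 6 * (1024 / (δ' ^ 3 * M ^ 3)) = (512 / 3) / (δ' ^ 3 * M ^ 3) by ring]
    rw [div_le_iff₀ (by positivity)]
    nlinarith
  have hL1 : 1 ≤ L - 1 := by linarith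
  -- the near index set is finite
  set T : Set {q : E3 // q ∈ Y ∧ q ≠ p} := {q | dist p q.1 < L} with hT
  have hTfin : T.Finite := by
    have hfin : (Y ∩ closedBall p L).Finite :=
      finite_of_forall_le_dist_of_subset_closedBall hδ'0
        (fun a ha b hb hab => hsep' a ha.1 b hb.1 hab) Set.inter_subset_right
    have hpre : (Subtype.val ⁻¹' (Y ∩ closedBall p L) : Set {q : E3 // q ∈ Y ∧ q ≠ p}).Finite :=
      hfin.preimage Subtype.val_injective.injOn
    refine hpre.subset fun q hq => ⟨q.2.1, ?_⟩
    rw [mem_closedBall, dist_comm]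
    exact le_of_lt hq
  set s : Finset {q : E3 // q ∈ Y ∧ q ≠ p} := hTfin.toFinset with hs_def
  have hs : ∀ q, dist p q.1 < L → q ∈ s := fun q hq => hTfin.mem_toFinset.2 hq
  have hs' : ∀ q ∈ s, dist p q.1 < L := fun q hq => hTfin.mem_toFinset.1 hq
  -- far part of `Y`: non-positive terms
  have hsplit := hsumm.sum_add_tsum_subtype_compl s
  have hfarY : ∑' q : {q : {q : E3 // q ∈ Y ∧ q ≠ p} // q ∉ s}, f q.1 ≤ 0 := by
    refine tsum_nonpos fun q => lennardJones_nonpos ?_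
    have : ¬ dist p q.1.1 < L := fun h => q.2 (hs q.1 h)
    linarith [not_lt.1 this]
  -- near part: continuity of the finite site sum at the limit positions
  set v₀ : E3 × (↥s → E3) := (p, fun i => i.1.1) with hv₀
  have hv₀ne : ∀ i : ↥s, v₀.1 ≠ v₀.2 i := fun i => Ne.symm i.1.2.2
  have hcont := continuousAt_sum_lennardJones_dist hv₀ne
  obtain ⟨γ, hγ, hγc⟩ := Metric.continuousAt_iff.1 hcont (η / 3) (by positivity)
  have hΦ₀ : ∑ i : ↥s, lennardJones (dist v₀.1 (v₀.2 i)) = ∑ q ∈ s, f q := by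
    rw [hv₀]
    exact Finset.sum_coe_sort s f
  -- the matching scale
  set ε : ℝ := min (γ / 2) (min (δ' / 4) (1 / 2)) with hε
  have hε0 : 0 < ε := by positivity
  have hεγ : ε < γ := (min_le_left _ _).trans_lt (by linarith)
  have hεδ' : ε ≤ δ' / 4 := (min_le_right _ _).trans (min_le_left _ _)
  have hε1' : ε ≤ 1 / 2 := (min_le_right _ _).trans (min_le_right _ _)
  have hεδ : 4 * ε ≤ δ' := by linarith
  have hε1 : 2 * ε ≤ 1 := by linarith
  set R : ℝ := ‖p‖ + L + 1 with hR
  obtain ⟨Z, hZsep0, hZbd, hBM1, hBM2⟩ := happrox R ε hε0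
  have hZsep : ∀ p ∈ Z, ∀ q ∈ Z, p ≠ q → δ' ≤ dist p q := fun p hp q hq hpq =>
    hδ'δ.trans (hZsep0 p hp q hq hpq)
  -- the matching map `τ`
  choose! τ hτZ hτd using hBM1
  have hpR : dist p 0 ≤ R := by rw [dist_zero_right, hR]; linarith
  have hqR : ∀ q ∈ s, dist (q : {q : E3 // q ∈ Y ∧ q ≠ p}).1 0 ≤ R := by
    intro q hq
    rw [dist_zero_right]
    have h1 : ‖q.1‖ ≤ ‖p‖ + dist p q.1 := by
      rw [dist_eq_norm]
      linarith [norm_sub_norm_le q.1 p, norm_sub_rev p q.1]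
    have := hs' q hq
    rw [hR]; linarith
  have hτp : τ p ∈ Z ∧ dist (τ p) p ≤ ε := ⟨hτZ p hp hpR, hτd p hp hpR⟩
  have hτq : ∀ q ∈ s, τ (q : {q : E3 // q ∈ Y ∧ q ≠ p}).1 ∈ Z ∧ dist (τ q.1) q.1 ≤ ε :=
    fun q hq => ⟨hτZ q.1 q.2.1 (hqR q hq), hτd q.1 q.2.1 (hqR q hq)⟩
  -- `τ` separates matched points of `Y`
  have hτinj : ∀ y ∈ Y, ∀ y' ∈ Y, dist (τ y) y ≤ ε → dist (τ y') y' ≤ ε → τ y = τ y' → y = y' := by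
    intro y hy y' hy' h1 h2 h3
    by_contra hne
    have hd := hsep' y hy y' hy' hne
    have : dist y y' ≤ 2 * ε :=
      calc dist y y' ≤ dist (τ y) y + dist (τ y) y' := dist_triangle_left _ _ _
        _ ≤ ε + ε := by rw [h3]; exact add_le_add (h3 ▸ h1) h2
        _ = 2 * ε := by ring
    linarith
  set a : E3 := τ p with ha
  -- the matched points form `I ⊆ Z ∖ {a}`
  set I : Finset E3 := s.image fun q => τ q.1 with hI
  have hIZ : ∀ b ∈ I, b ∈ Z ∧ b ≠ a := by
    intro b hb
    obtain ⟨q, hq, rfl⟩ := Finset.mem_image.1 hb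
    refine ⟨(hτq q hq).1, fun h => ?_⟩
    exact q.2.2 (hτinj q.1 q.2.1 p hp (hτq q hq).2 hτp.2 h)
  have hinjs : Set.InjOn (fun q : {q : E3 // q ∈ Y ∧ q ≠ p} => τ q.1) s := by
    intro q hq q' hq' h
    exact Subtype.ext (hτinj q.1 q.2.1 q'.1 q'.2.1 (hτq q hq).2 (hτq q' hq').2 h)
  -- the unmatched points of `Z` are far from `a`
  have hfarZ : ∀ b ∈ Z, b ≠ a → b ∉ I → L - 1 ≤ dist b a := by
    intro b hbZ hba hbI
    by_contra hlt
    rw [not_le] at hlt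
    have hbR : dist b 0 ≤ R := by
      rw [dist_zero_right]
      have h1 : ‖b‖ ≤ ‖a‖ + dist b a := by
        rw [dist_eq_norm]; linarith [norm_sub_norm_le b a]
      have h2 : ‖a‖ ≤ ‖p‖ + dist a p := by
        rw [dist_eq_norm]; linarith [norm_sub_norm_le a p]
      rw [hR]; linarith [hτp.2]
    obtain ⟨y, hy, hby⟩ := hBM2 b hbZ hbR
    have hya : y ≠ p := by
      intro hyp
      rw [hyp] at hby
      have hd := hZsep a hτp.1 b hbZ (Ne.symm hba)
      have : dist a b ≤ 2 * ε :=
        calc dist a b ≤ dist a p + dist b p := dist_triangle_right _ _ _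
          _ ≤ ε + ε := add_le_add hτp.2 hby
          _ = 2 * ε := by ring
      linarith
    have hyL : dist p y < L :=
      calc dist p y ≤ dist p a + dist a b + dist b y := dist_triangle4 _ _ _ _
        _ < ε + (L - 1) + ε := by
            rw [dist_comm p a, dist_comm a b]
            linarith [hτp.2]
        _ ≤ L := by linarith
    have hys : (⟨y, hy, hya⟩ : {q : E3 // q ∈ Y ∧ q ≠ p}) ∈ s := hs ⟨y, hy, hya⟩ hyL
    have hτy := hτq _ hys
    have hbτ : b = τ y := by
      by_contra hne
      have hd := hZsep b hbZ (τ y) hτy.1 hne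
      have : dist b (τ y) ≤ 2 * ε :=
        calc dist b (τ y) ≤ dist b y + dist (τ y) y := dist_triangle_right _ _ _
          _ ≤ ε + ε := add_le_add hby hτy.2
          _ = 2 * ε := by ring
      linarith
    exact hbI (Finset.mem_image.2 ⟨⟨y, hy, hya⟩, hys, hbτ.symm⟩)
  -- truncation of the site sum of `Z` at `a` (part II)
  have htr := sum_le_tsum_add_of_far hδ'0 hZsep a (by linarith : δ' ≤ L - 1) I hIZ hfarZ
  have hUa := hZbd a hτp.1
  have hsumI : ∑ b ∈ I, lennardJones (dist a b) =
      ∑ i : ↥s, lennardJones (dist a (τ i.1.1)) := by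
    rw [hI, Finset.sum_image hinjs]
    exact (Finset.sum_coe_sort s (fun q => lennardJones (dist a (τ q.1)))).symm
  -- continuity transfers the bound to the limit positions
  have hclose : dist ((a, fun i : ↥s => τ i.1.1) : E3 × (↥s → E3)) v₀ < γ := by
    rw [Prod.dist_eq, hv₀]
    refine max_lt (hτp.2.trans_lt hεγ) ?_
    exact lt_of_le_of_lt ((dist_pi_le_iff hε0.le).2 fun i => (hτq i.1 i.2).2) hεγ
  have h1 := hγc hclose
  rw [Real.dist_eq] at h1
  simp only at h1
  rw [hΦ₀, ← hsumI] at h1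
  have hnear : ∑ q ∈ s, f q ≤ B + η / 3 + η / 3 := by
    have := (abs_lt.1 h1).1
    linarith
  calc ∑' q, f q = ∑ q ∈ s, f q + ∑' q : {q // q ∉ s}, f q.1 := hsplit.symm
    _ ≤ B + η := by linarith

/-! ## Registered sub-goal of `stub_cohesion`: site bounds of local limits -/

/-- **Sub-goal `stub_cohesion_siteBoundOfLocalLimit` of the stub `stub_cohesion`** (registered on
stmt-AtomisticToContinuum-15099): uniform Lennard-Jones site bounds pass to local limits of
separated sets (`tsum_site_le_of_forall_exists_ballMatch` in arrow form). [folklore] -/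
theorem stub_cohesion_siteBoundOfLocalLimit :
    ∀ (δ B : ℝ), 0 < δ → ∀ Y : Set (EuclideanSpace ℝ (Fin 3)),
      (∀ p ∈ Y, ∀ q ∈ Y, p ≠ q → δ ≤ dist p q) →
      (∀ R ε : ℝ, 0 < ε → ∃ Z : Set (EuclideanSpace ℝ (Fin 3)),
        (∀ p ∈ Z, ∀ q ∈ Z, p ≠ q → δ ≤ dist p q) ∧
        (∀ p ∈ Z, ∑' q : {q : EuclideanSpace ℝ (Fin 3) // q ∈ Z ∧ q ≠ p},
          lennardJones (dist p q.1) ≤ B) ∧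
        BallMatch ε R 0 Z Y) →
      ∀ p ∈ Y, ∑' q : {q : EuclideanSpace ℝ (Fin 3) // q ∈ Y ∧ q ≠ p},
        lennardJones (dist p q.1) ≤ B :=
  fun _ _ hδ _ hsep happrox _ hp => tsum_site_le_of_forall_exists_ballMatch hδ hsep happrox hp

end Summit.AtomisticToContinuum.Crystallization.Theorems.PerronTransitivityUniformBindingRigidity

end
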